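/-
Copyright: lead seat `ym-line-sll-p1` (prover-ym-line-sll-p1-g0-0), route `SoftLoopLongLag`, cruxes `ColdBoxSoftLoopLagFloor`
(stmt-QuantumFields-22503, stub S2b `stub_datumStabilityLoopG`) and `SoftLoopLagFloorToTorus` (stmt-QuantumFields-22504, stub K2 `stub_meanSmoothG`).
-/
import Summits.QuantumFields.YangMills.Theorems.SoftLoopLongLagColdBoxSoftLoopLagFloorStubGaussCore
import Summits.QuantumFields.YangMills.Theorems.SourcedPressureJensenSourcedPressureIncrementCurvatureDecay

/-!
# Free lattice-Maxwell mutual inductances of time-separated `R×R` squares are `O(1)` (route `SoftLoopLongLag`, G-free bookkeeping)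

WHAT.  There is an absolute constant `C` such that for every side `R` and all base points `x, y ∈ ℤ⁴` whose time coordinates differ by at
least `R`, the mutual inductance of the `(1,2)`-squares satisfies `|mutualInductance x y R| ≤ C` (`exists_abs_mutualInductance_le_of_time_sep`):
each of the `R⁴` plaquette pairs is at distance `≥ R`, where the curvature kernel is `≤ C₀(1 + dist)^{−4}` (tree
`exists_abs_curvatureTwoPoint_parallel_le_one_add`, Lawler's asymptotics), and `R⁴ (1+R)^{−4} ≤ 1`.  Consequently the lag-`T` double sums over
the time-zero cube are `≤ C·#(timeZeroCube R)²` for `T ≥ R` (`sum_sum_abs_mutualInductance_lag_le`).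

WHY.  These are the sizes entering the weight-drift part (ii) of the background term of S2b (`β·Σ w δw' M ≤ β·w_max·δw_max·Σ|M|`) and
the same-datum mean-smoothness bookkeeping of K2 (cards `Cruxes/ColdBoxSoftLoopLagFloor/Lines/birth.md`, `Cruxes/SoftLoopLagFloorToTorus/Lines/birth.md`).

HONEST LABEL.  Free-field bookkeeping for a RECORD-label rung line (R2xi-G, leaf `WeakCouplingRates.XiPow` = an UPPER bound on the lattice mass gap);
NOT the Clay mass gap; no summit statement is touched.

References: G. Lawler, *Intersections of Random Walks* (1991) Thm 1.5.5; C. Garban, A. Sepúlveda, IMRN 2023 §4.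
-/

set_option autoImplicit false

noncomputable section

open Finset Real
open Literature.Probability.LatticeModels (Site)
open Literature.MathematicalPhysics.QuantumLattice (ZdPlaquette)
open Literature.MathematicalPhysics.QuantumFieldTheory (curvatureTwoPoint)
open Summit.QuantumFields.YangMills.Cruxes.SourcedPressureIncrement.Birth (exists_abs_curvatureTwoPoint_parallel_le_one_add)

namespace Summit.QuantumFields.YangMills.Theorems.SoftLoopLongLag

/-- The Euclidean norm of an integer vector dominates the modulus of its time coordinate. -/
theorem abs_apply_zero_le_sqrt_sum_sq (z : Site 4) : |((z 0 : ℤ) : ℝ)| ≤ Real.sqrt (∑ k, (((z k : ℤ)) : ℝ) ^ 2) := by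
  rw [← Real.sqrt_sq_eq_abs]
  exact Real.sqrt_le_sqrt (Finset.single_le_sum (f := fun k => (((z k : ℤ)) : ℝ) ^ 2) (fun k _ => sq_nonneg _) (Finset.mem_univ 0))

/-- **Time-separated squares have bounded mutual inductance.**  There is `C ≥ 0` with `|mutualInductance x y R| ≤ C` whenever the time
coordinates of the base points differ by at least `R`: `R ≤ |x₀ − y₀|`. -/
theorem exists_abs_mutualInductance_le_of_time_sep : ∃ C : ℝ, 0 ≤ C ∧ ∀ (R : ℕ) (x y : Site 4),
    (R : ℝ) ≤ |(((x 0 - y 0 : ℤ)) : ℝ)| → |mutualInductance x y R| ≤ C := by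
  obtain ⟨C₀, hC₀, hdec⟩ := exists_abs_curvatureTwoPoint_parallel_le_one_add (d := 4) (by norm_num)
  refine ⟨C₀, hC₀, fun R x y hsep => ?_⟩
  have hR0 : (0 : ℝ) ≤ R := Nat.cast_nonneg _
  -- every plaquette pair is at distance `≥ R`, so each kernel value is `≤ C₀ (1+R)^{-4}`
  have hterm : ∀ a b a' b' : ℕ,
      |curvatureTwoPoint ((x + Pi.single 1 (a : ℤ) + Pi.single 2 (b : ℤ), ⟨((1 : Fin 4), (2 : Fin 4)), by decide⟩) : ZdPlaquette 4)
          (y + Pi.single 1 (a' : ℤ) + Pi.single 2 (b' : ℤ), ⟨((1 : Fin 4), (2 : Fin 4)), by decide⟩)| ≤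
        C₀ * ((1 + (R : ℝ)) ^ 4)⁻¹ := by
    intro a b a' b'
    set p : Site 4 := x + Pi.single 1 (a : ℤ) + Pi.single 2 (b : ℤ) with hp
    set q : Site 4 := y + Pi.single 1 (a' : ℤ) + Pi.single 2 (b' : ℤ) with hq
    have h := hdec p q ⟨((1 : Fin 4), (2 : Fin 4)), by decide⟩
    set r : ℝ := Real.sqrt (∑ k, ((((p - q) k : ℤ)) : ℝ) ^ 2) with hr
    have hpq0 : (p - q) 0 = x 0 - y 0 := by
      simp [hp, hq]
    have hRr : (R : ℝ) ≤ r := by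
      have := abs_apply_zero_le_sqrt_sum_sq (p - q)
      rw [hpq0] at this
      exact hsep.trans this
    have h1R : (0 : ℝ) < 1 + R := by linarith
    have hmono : (1 + r) ^ (-((4 : ℕ) : ℝ)) ≤ ((1 + (R : ℝ)) ^ 4)⁻¹ := by
      rw [Real.rpow_neg (by linarith [Real.sqrt_nonneg (∑ k, ((((p - q) k : ℤ)) : ℝ) ^ 2)]), Nat.cast_ofNat,
        show ((4 : ℝ)) = ((4 : ℕ) : ℝ) by norm_num, Real.rpow_natCast]
      exact inv_anti₀ (pow_pos h1R 4) (pow_le_pow_left₀ h1R.le (by linarith) 4)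
    exact h.trans (mul_le_mul_of_nonneg_left hmono hC₀)
  -- sum the `R² × R²` bounds
  rw [mutualInductance, sum_rectSurface_eq]
  simp_rw [sum_rectSurface_eq y]
  calc |∑ a ∈ range R, ∑ b ∈ range R, ∑ a' ∈ range R, ∑ b' ∈ range R,
          curvatureTwoPoint ((x + Pi.single 1 (a : ℤ) + Pi.single 2 (b : ℤ), ⟨((1 : Fin 4), (2 : Fin 4)), by decide⟩) : ZdPlaquette 4)
            (y + Pi.single 1 (a' : ℤ) + Pi.single 2 (b' : ℤ), ⟨((1 : Fin 4), (2 : Fin 4)), by decide⟩)|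
      ≤ ∑ a ∈ range R, ∑ b ∈ range R, ∑ a' ∈ range R, ∑ b' ∈ range R, C₀ * ((1 + (R : ℝ)) ^ 4)⁻¹ := by
        refine (abs_sum_le_sum_abs _ _).trans (sum_le_sum fun a _ => ?_)
        refine (abs_sum_le_sum_abs _ _).trans (sum_le_sum fun b _ => ?_)
        refine (abs_sum_le_sum_abs _ _).trans (sum_le_sum fun a' _ => ?_)
        exact (abs_sum_le_sum_abs _ _).trans (sum_le_sum fun b' _ => hterm a b a' b')
    _ = (R : ℝ) ^ 4 * (C₀ * ((1 + (R : ℝ)) ^ 4)⁻¹) := by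
        simp only [sum_const, card_range, nsmul_eq_mul]
        ring
    _ ≤ C₀ := by
        have h1R : (0 : ℝ) < (1 + (R : ℝ)) ^ 4 := by positivity
        have hR4 : (R : ℝ) ^ 4 ≤ (1 + (R : ℝ)) ^ 4 := pow_le_pow_left₀ hR0 (by linarith) 4
        rw [show (R : ℝ) ^ 4 * (C₀ * ((1 + (R : ℝ)) ^ 4)⁻¹) = C₀ * ((R : ℝ) ^ 4 / (1 + (R : ℝ)) ^ 4) by ring]
        exact (mul_le_mul_of_nonneg_left ((div_le_one h1R).2 hR4) hC₀).trans (mul_one C₀).le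

/-- **Lag-`T` inductance sums over the time-zero cube are `O(#cube²)`**: for `T ≥ R` and the constant `C` of
`exists_abs_mutualInductance_le_of_time_sep`, `Σ_{x,x' ∈ timeZeroCube R} |mutualInductance x (x' + T e₀) R| ≤ C · #(timeZeroCube R)²`. -/
theorem sum_sum_abs_mutualInductance_lag_le : ∃ C : ℝ, 0 ≤ C ∧ ∀ (R T : ℕ), R ≤ T →
    ∑ x ∈ timeZeroCube R, ∑ x' ∈ timeZeroCube R, |mutualInductance x (x' + Pi.single 0 (T : ℤ)) R| ≤
      C * ((timeZeroCube R).card : ℝ) ^ 2 := by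
  obtain ⟨C, hC, hM⟩ := exists_abs_mutualInductance_le_of_time_sep
  refine ⟨C, hC, fun R T hRT => ?_⟩
  calc ∑ x ∈ timeZeroCube R, ∑ x' ∈ timeZeroCube R, |mutualInductance x (x' + Pi.single 0 (T : ℤ)) R|
      ≤ ∑ x ∈ timeZeroCube R, ∑ _x' ∈ timeZeroCube R, C := by
        refine sum_le_sum fun x hx => sum_le_sum fun x' hx' => hM R x _ ?_
        have hx0 : x 0 = 0 := (mem_filter.1 hx).2
        have hx'0 : x' 0 = 0 := (mem_filter.1 hx').2
        simp only [Pi.add_apply, Pi.single_eq_same, hx0, hx'0, zero_add, zero_sub, Int.cast_neg, Int.cast_natCast, abs_neg,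
          Nat.abs_cast]
        exact_mod_cast hRT
    _ = C * ((timeZeroCube R).card : ℝ) ^ 2 := by
        simp only [sum_const, nsmul_eq_mul]
        ring

end Summit.QuantumFields.YangMills.Theorems.SoftLoopLongLag

end
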